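/-
Copyright (c) 2026 the pub-hodgecm-mathlib formalisation cell (harness21).  Prover seat hodgecm-mathlib-K2E1-p10 (g0), Track B ∕ K2-LIT, h413 = `stmt-HodgeConjecture-24833`,
line `K2_E1_TraceFormulaBeta`, campaign «EIS-WHITTAKER-3», WAVE 2 letter «W-hWbd₃» FILE C2₃-A (dealer K2E1-plan (g5) RE-KEY 2026-09-04T08:47:04Z, RULING 08:54:29Z «P1 = C2₃-A
TOKEN-ABSTRACT»): THE GLOBAL FINITE PART of the Whittaker coefficient of the spherical Eisenstein series on `U(2,1)_{L∕L⁺}` ASSEMBLED FROM PER-PLACE PACKAGES — holomorphic on the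
window `{1 < Re z}`, of divisor-type growth in the frequency, supported on a box: the (hWhol, polynomial hWbd) face of ★ W4, with the local-factor TOKEN left as a letter.
-/
import Summits.HodgeConjecture.HodgeConjecture.Theorems.K2E1WhittakerGrowthPlacesOverU3    -- ★ P3 (this seat): `exists_prod_extension_two_mul_succ_pow_le` (★ #1b re-indexed along `(v, w ∣ v) ↔ w`)
import Mathlib.Analysis.Calculus.Deriv.Mul                                             -- `DifferentiableOn.finsetProd`
import HarnessLib

/-!
# K2·E1 — `K2E1WhittakerFinitePartU3` («EIS-WHITTAKER-3», «W-hWbd₃», FILE C2₃-A): THE FINITE PART `W_f(z, ξ) = ∏_{v ∈ S(ξ)} W_v(ξ, z)` FROM PER-PLACE PACKAGES —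
# HOLOMORPHIC ON `{1 < Re z}`, `‖W_f(z, ξ)‖ ≤ C·(1 + ‖ξ_∞‖)^a` ON `Re z ≥ σ₁ > 1`, ZERO OFF THE BOX

Track B ∕ K2-LIT, crux h413 = `stmt-HodgeConjecture-24833`, route of record `HCCMUnconditional`; cell `hodgecm-mathlib`, squad K2, ENGINE E1 (campaign «EIS-WHITTAKER-3», WAVE 2).
THEOREMS ONLY (no `def`, no `instance`, no notation, no named-fact hypothesis, no `sorry`; default heartbeats); lane `--supports stmt-HodgeConjecture-24833 --as helper` (count-neutral).
GENERIC `L ∕ K` number fields (`= L ∕ L⁺`).  TOKEN-ABSTRACT BY RULING (dealer 08:54:29Z): the local Whittaker factor at a finite place `v` of `K` — an integral over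
`E_v × K_v = (∏_{w∣v} L_w) × K_v` whose Lean token is fixed by W3₃ FILE B (K2E4-p10 (g5), not yet ★) — enters as a LETTER `Wloc : L → places(K) → ℂ → ℂ` (`Wloc ξ v z` = the
normalised factor `W_v(ξ, z)` of ★ W3₃-A `K2E1WhittakerCoefficientEulerProductU3.hasProd_mul_inv_den_of_eq_off`'s abstract `W`), together with the finite sets `S ξ` off which the factor is
the unit value (the `hW` letters of ★ W3₃-A), the BOX `e : places(L) → ℤ` (`e_w = 0` a.e.) and the ORDERS `n ξ w = ord_w ξ − e_w`.  The per-place ANALYTIC packages are ★ and will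
instantiate the hypotheses below place by place once the token is ★: inert `v` ↦ ★ C1₃ `K2E1LocalWhittakerPackageU3.exists_entire_inertWhittakerPackage` (entire, `‖·‖ ≤ 4(n_w+1)
≤ (2(n_w+1))²` on `Re ≥ 1`, zero for `ξ_w ∉ 𝔭^{m_w}`); split `v = ww̄` ↦ ★ C1₃-split `K2E1LocalWhittakerPackageSplitU3.exists_window_splitWhittakerPackage` (holomorphic on `{1 < Re}`,
`‖·‖ ≤ M(σ₁) ≤ 4^k ≤ (∏_{w∣v} …)^k` on `Re ≥ σ₁` by ★ P3 `four_le_prod_extension_ite_of_exists`, zero off the lattice); bad `v ∈ S₀` ↦ ★ D-W5 `K2E1FiniteWhittakerStepSymbolU3[Tail]`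
(entire shell sums, `‖·‖ ≤ B·(n_w+1)`, threshold).

THE MATHEMATICS [Garrett2018, §1.10, §2.8; Bump1997, §3.7; MoeglinWaldspurger1995, I.2.10].  HYPOTHESES (letters, per `ξ ≠ 0` in the box `∀ w, ξ ∈ 𝔭_w^{e_w}`):
 (hhol) `v ∈ S ξ ⟹ z ↦ Wloc ξ v z` holomorphic on `U := {1 < Re z}`;
 (hbd)  for every `σ₁ > 1` ONE `B ≥ 1` and ONE `k` with `‖Wloc ξ v z‖ ≤ (v ∈ S₀ ? B : 1) · ω_ξ(v)^k` for `v ∈ S ξ`, `Re z ≥ σ₁`, where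
        `ω_ξ(v) := ∏_{w ∣ v} (if w ∈ S₀′ ∨ 1 ≤ n ξ w then 2(n ξ w + 1) else 1)` (★ P3's weight; `S₀ ⊆ places(K)`, `S₀′ ⊆ places(L)` fixed finite sets);
 (hn)   order honesty: at `w ∣ v ∈ S ξ` with `w ∈ S₀′ ∨ 1 ≤ n ξ w`, `ξ ∈ 𝔭_w^{e_w + n ξ w} ∖ 𝔭_w^{e_w + n ξ w + 1}`;
 (hvan) below the box the factor dies: `ξ ∉ 𝔭_w^{e_w} ⟹ w.under ∈ S ξ ∧ Wloc ξ (w.under) = 0`.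
CONCLUSIONS for `W_f(z, ξ) := ∏_{v ∈ S ξ} Wloc ξ v z` (NO new token — a `Finset.prod` of the letter):
 (hol)  `z ↦ W_f(z, ξ)` holomorphic on `{1 < Re z}` for every `ξ` (finite product);
 (bd)   for every `σ₁ > 1` ONE `C ≥ 0` and ONE `a` with `‖W_f(z, ξ)‖ ≤ C·(1 + ‖ξ_∞‖)^a` for ALL `ξ ≠ 0` in the box and ALL `Re z ≥ σ₁`
        (`∏_{v∈S ξ} (B?)·ω^k ≤ B^{#S₀}·(∏_v ω_ξ(v))^k ≤ B^{#S₀}·C_{P3}^k·(1+‖ξ_∞‖)^{2[L:ℚ]k}` — ★ P3 = ★ #1b re-indexed; `a = 2[L:ℚ]k(σ₁)`);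
 (supp) `ξ ≠ 0` outside the box ⟹ `W_f(z, ξ) = 0` for every `z`.
This is EXACTLY the (hWhol, polynomial-in-`ξ` hWbd on neighbourhoods `{Re z > σ₁} ∋ z₀`) face that ★ W4 `K2E1WhittakerSeriesConvergenceU2.summable_differentiableOn_tsum_of_exp_bounds` (with `K := L`,
`U = {1 < Re}`) consumes after C3₃ multiplies by the archimedean factor (`M e^{−b‖ξ_∞‖}`, ★ D-W2 B p858583) and by `D^{S(ξ)}(z)⁻¹` (★ DEN `K2E1WhittakerDenBoundsUniformU3`, uniform in
`S ⊇ S₀`).  HONEST SCOPE: the window is OPEN — no bound on the closed half-plane `Re z ≥ 1` is claimed (the split packages' constant `(1−2^{1−σ₁})⁻²…` blows up as `σ₁ → 1⁺`); locally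
uniform is all ★ W4 asks.  The (eq)∕(unr) identifications of `Wloc` with the integral token are NOT in this file (they are definitional once W3₃-B names the token).
* §1 finite products of window-holomorphic functions; norms of finite products against `(B?)·ω^k`; §2 HEAD **`exists_finitePart_bounds_of_packages`** ((hol)(bd)(supp) for the `Finset.prod`);
  §3 the CM reading `K = L⁺ := maximalRealSubfield L` (no new content, binder specialisation for C3₃).
SAT-WITNESS: nothing is quantified over a structure; with `Wloc := 1`, `S := ∅` every hypothesis holds and `W_f = 1`.
HONEST LABEL: HC_CM is proved only modulo the 7 printed citations (2 remaining named inputs: hLiu418 = `stmt-HodgeConjecture-24832`, h413 = `stmt-HodgeConjecture-24833`)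
until rung 0 closes; this file asserts no named fact and closes no socket; CONDITIONAL BY CONSTRUCTION on the letters (hhol)(hbd)(hn)(hvan) (payers named above); count-neutral.
References: [Garrett2018] §1.10, §2.8 · [Bump1997] §3.7 · [MoeglinWaldspurger1995] I.2.10 · [NeukirchANT1999] Ch. III (1.3).
-/

set_option autoImplicit false
-- the mandated namespace repeats the single-problem summit's segment (`HodgeConjecture.HodgeConjecture`)
set_option linter.dupNamespace false

noncomputable section

open scoped NNReal Classical
open NumberField NumberField.mixedEmbedding IsDedekindDomain IsDedekindDomain.HeightOneSpectrum Module Filter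
open Literature.NumberTheory.Automorphic
open Summit.HodgeConjecture.HodgeConjecture.Cruxes.H413.K2E1WhittakerGrowthPlacesOverU3

namespace Summit.HodgeConjecture.HodgeConjecture.Cruxes.H413.K2E1WhittakerFinitePartU3

variable {K L : Type} [Field K] [NumberField K] [Field L] [NumberField L] [Algebra K L]

/-! ## §1  Finite products: holomorphy on the window, norm against the per-place weights -/

/-- A finite product of functions holomorphic on `{1 < Re z}` is holomorphic there. [folklore] -/
theorem differentiableOn_finsetProd_window {ι : Type*} (T : Finset ι) {f : ι → ℂ → ℂ} (hf : ∀ i ∈ T, DifferentiableOn ℂ (f i) {z : ℂ | 1 < z.re}) :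
    DifferentiableOn ℂ (fun z => ∏ i ∈ T, f i z) {z : ℂ | 1 < z.re} :=
  DifferentiableOn.fun_finsetProd hf

/-- `‖∏_{v ∈ T} a_v‖ ≤ ∏_{v ∈ T} b_v` when `‖a_v‖ ≤ b_v` termwise. [folklore] -/
theorem norm_prod_le_prod_of_le {ι : Type*} (T : Finset ι) {a : ι → ℂ} {b : ι → ℝ} (h : ∀ i ∈ T, ‖a i‖ ≤ b i) : ‖∏ i ∈ T, a i‖ ≤ ∏ i ∈ T, b i :=
  (Finset.norm_prod_le T a).trans (Finset.prod_le_prod (fun _ _ => norm_nonneg _) h)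

/-- The constants at the fixed bad places: `∏_{v ∈ T} (if v ∈ S₀ then B else 1) ≤ B^{#S₀}` for `B ≥ 1`. [folklore] -/
theorem prod_ite_const_le_pow_card {ι : Type*} (T S₀ : Finset ι) {B : ℝ} (hB : 1 ≤ B) :
    ∏ v ∈ T, (if v ∈ S₀ then B else 1) ≤ B ^ S₀.card := by
  rw [← Finset.prod_filter, Finset.prod_const]
  calc B ^ (T.filter fun v => v ∈ S₀).card ≤ B ^ S₀.card :=
        pow_le_pow_right₀ hB (Finset.card_le_card (fun v hv => (Finset.mem_filter.1 hv).2))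
    _ = B ^ S₀.card := rfl

/-- Splitting the per-place majorant: `∏_{v∈T} (c_v · ω_v^k) = (∏_v c_v)·(∏_v ω_v)^k`. [folklore] -/
theorem prod_mul_pow_eq {ι : Type*} (T : Finset ι) (c ω : ι → ℝ) (k : ℕ) :
    ∏ v ∈ T, (c v * ω v ^ k) = (∏ v ∈ T, c v) * (∏ v ∈ T, ω v) ^ k := by
  rw [Finset.prod_mul_distrib, Finset.prod_pow]

/-! ## §2  THE FINITE PART FROM PER-PLACE PACKAGES -/

/-- **THE GLOBAL FINITE PART OF THE WHITTAKER COEFFICIENT OF `U(2,1)_{L∕K}` FROM PER-PLACE PACKAGES** (token-abstract; `L ∕ K` number fields, `U = {1 < Re z}`).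
LETTERS: `Wloc ξ v z` (the normalised local factor at the finite place `v` of `K`), `S ξ` (the finite set off which it is the unit value), the box `e` (`e_w = 0` a.e.), the orders
`n ξ w`, finite sets `S₀ ⊆ places(K)`, `S₀′ ⊆ places(L)`.  HYPOTHESES: (hhol) holomorphy on `U` at `v ∈ S ξ`; (hbd) for every `σ₁ > 1` one `B ≥ 1`, `k` with
`‖Wloc ξ v z‖ ≤ (if v ∈ S₀ then B else 1)·(∏_{w∣v} (if w ∈ S₀′ ∨ 1 ≤ n ξ w then 2(n ξ w+1) else 1))^k` (`v ∈ S ξ`, `Re z ≥ σ₁`, `ξ ≠ 0` in the box); (hn) order honesty at those `w`;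
(hvan) `ξ ∉ 𝔭_w^{e_w} ⟹ w.under ∈ S ξ ∧ Wloc ξ (w.under) = 0`.  CONCLUSIONS for `W_f(z,ξ) := ∏_{v ∈ S ξ} Wloc ξ v z`: (hol) holomorphic on `U` for every `ξ`; (bd) for every `σ₁ > 1`
ONE `C ≥ 0`, `a` with `‖W_f(z,ξ)‖ ≤ C(1+‖ξ_∞‖)^a` for all `ξ ≠ 0` in the box, `Re z ≥ σ₁` (★ P3); (supp) `ξ ≠ 0` off the box ⟹ `W_f(·,ξ) = 0`.
[cite: Garrett2018, §2.8] [cite: Bump1997, §3.7] [cite: MoeglinWaldspurger1995, I.2.10] -/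
theorem exists_finitePart_bounds_of_packages (Wloc : L → HeightOneSpectrum (𝓞 K) → ℂ → ℂ) (S : L → Finset (HeightOneSpectrum (𝓞 K)))
    {e : HeightOneSpectrum (𝓞 L) → ℤ} (he : ∀ᶠ w in cofinite, e w = 0) (n : L → HeightOneSpectrum (𝓞 L) → ℕ)
    (S₀ : Finset (HeightOneSpectrum (𝓞 K))) (S₀' : Finset (HeightOneSpectrum (𝓞 L)))
    (hhol : ∀ ξ : L, ∀ v ∈ S ξ, DifferentiableOn ℂ (Wloc ξ v) {z : ℂ | 1 < z.re})
    (hbd : ∀ σ₁ : ℝ, 1 < σ₁ → ∃ (B : ℝ) (k : ℕ), 1 ≤ B ∧ ∀ ξ : L, ξ ≠ 0 →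
      (∀ w : HeightOneSpectrum (𝓞 L), (ξ : w.adicCompletion L) ∈ primePowBall (w.adicCompletion L) (e w)) →
      ∀ v ∈ S ξ, ∀ z : ℂ, σ₁ ≤ z.re →
        ‖Wloc ξ v z‖ ≤ (if v ∈ S₀ then B else 1) *
          (letI := Extension.fintype (𝓞 K) K L (𝓞 L) v; ∏ w : v.Extension (𝓞 L), (if w.1 ∈ S₀' ∨ 1 ≤ n ξ w.1 then 2 * ((n ξ w.1 : ℝ) + 1) else 1)) ^ k)
    (hn : ∀ ξ : L, ξ ≠ 0 → (∀ w : HeightOneSpectrum (𝓞 L), (ξ : w.adicCompletion L) ∈ primePowBall (w.adicCompletion L) (e w)) →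
      ∀ v ∈ S ξ, ∀ w : v.Extension (𝓞 L), (w.1 ∈ S₀' ∨ 1 ≤ n ξ w.1) →
        (ξ : w.1.adicCompletion L) ∈ primePowBall (w.1.adicCompletion L) (e w.1 + n ξ w.1) ∧
          (ξ : w.1.adicCompletion L) ∉ primePowBall (w.1.adicCompletion L) (e w.1 + n ξ w.1 + 1))
    (hvan : ∀ ξ : L, ξ ≠ 0 → ∀ w : HeightOneSpectrum (𝓞 L), (ξ : w.adicCompletion L) ∉ primePowBall (w.adicCompletion L) (e w) →
      w.under (𝓞 K) ∈ S ξ ∧ Wloc ξ (w.under (𝓞 K)) = 0) :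
    (∀ ξ : L, DifferentiableOn ℂ (fun z => ∏ v ∈ S ξ, Wloc ξ v z) {z : ℂ | 1 < z.re}) ∧
    (∀ σ₁ : ℝ, 1 < σ₁ → ∃ (C : ℝ) (a : ℕ), 0 ≤ C ∧ ∀ ξ : L, ξ ≠ 0 →
      (∀ w : HeightOneSpectrum (𝓞 L), (ξ : w.adicCompletion L) ∈ primePowBall (w.adicCompletion L) (e w)) →
      ∀ z : ℂ, σ₁ ≤ z.re → ‖∏ v ∈ S ξ, Wloc ξ v z‖ ≤ C * (1 + ‖mixedEmbedding L ξ‖) ^ a) ∧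
    (∀ ξ : L, ξ ≠ 0 → (∃ w : HeightOneSpectrum (𝓞 L), (ξ : w.adicCompletion L) ∉ primePowBall (w.adicCompletion L) (e w)) →
      ∀ z : ℂ, ∏ v ∈ S ξ, Wloc ξ v z = 0) := by
  refine ⟨fun ξ => differentiableOn_finsetProd_window (S ξ) (hhol ξ), fun σ₁ hσ₁ => ?_, fun ξ hξ ⟨w, hw⟩ z => ?_⟩
  · -- (bd): per-place majorants, the constants at `S₀`, and ★ P3 for the weights
    obtain ⟨B, k, hB, hbd'⟩ := hbd σ₁ hσ₁
    obtain ⟨C, hC, hP3⟩ := exists_prod_extension_two_mul_succ_pow_le (K := K) he S₀' k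
    refine ⟨B ^ S₀.card * C ^ k, 2 * finrank ℚ L * k, by positivity, fun ξ hξ hbox z hz => ?_⟩
    have hω1 : ∀ v : HeightOneSpectrum (𝓞 K), (1 : ℝ) ≤
        (letI := Extension.fintype (𝓞 K) K L (𝓞 L) v; ∏ w : v.Extension (𝓞 L), (if w.1 ∈ S₀' ∨ 1 ≤ n ξ w.1 then 2 * ((n ξ w.1 : ℝ) + 1) else 1)) :=
      fun v => one_le_prod_extension_ite S₀' (n ξ) v
    calc ‖∏ v ∈ S ξ, Wloc ξ v z‖
        ≤ ∏ v ∈ S ξ, ((if v ∈ S₀ then B else 1) *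
            (letI := Extension.fintype (𝓞 K) K L (𝓞 L) v; ∏ w : v.Extension (𝓞 L), (if w.1 ∈ S₀' ∨ 1 ≤ n ξ w.1 then 2 * ((n ξ w.1 : ℝ) + 1) else 1)) ^ k) :=
          norm_prod_le_prod_of_le _ fun v hv => hbd' ξ hξ hbox v hv z hz
      _ = (∏ v ∈ S ξ, (if v ∈ S₀ then B else 1)) *
            (∏ v ∈ S ξ, (letI := Extension.fintype (𝓞 K) K L (𝓞 L) v; ∏ w : v.Extension (𝓞 L), (if w.1 ∈ S₀' ∨ 1 ≤ n ξ w.1 then 2 * ((n ξ w.1 : ℝ) + 1) else 1))) ^ k :=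
          prod_mul_pow_eq _ _ _ _
      _ ≤ B ^ S₀.card * (C ^ k * (1 + ‖mixedEmbedding L ξ‖) ^ (2 * finrank ℚ L * k)) := by
          refine mul_le_mul (prod_ite_const_le_pow_card _ _ hB) (hP3 ξ hξ hbox (S ξ) (n ξ) (hn ξ hξ hbox)) ?_ (by positivity)
          exact pow_nonneg (Finset.prod_nonneg fun v _ => zero_le_one.trans (hω1 v)) _
      _ = B ^ S₀.card * C ^ k * (1 + ‖mixedEmbedding L ξ‖) ^ (2 * finrank ℚ L * k) := (mul_assoc _ _ _).symm
  · -- (supp): the factor above `w` is in the product and vanishes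
    obtain ⟨hmem, hzero⟩ := hvan ξ hξ w hw
    exact Finset.prod_eq_zero hmem (by rw [hzero]; rfl)

/-- **(bd) ON NEIGHBOURHOODS** (the literal shape of ★ W4's `hWbd` for the finite part): around every `z₀` with `1 < Re z₀` there is a neighbourhood `V` and ONE `C ≥ 0`, `a` with
`‖W_f(z, ξ)‖ ≤ C·(1 + ‖ξ_∞‖)^a` for all `z ∈ V` and all `ξ ≠ 0` in the box (take `σ₁ = (1 + Re z₀)∕2`, `V = {σ₁ < Re z}`). [cite: Garrett2018, §2.8] [cite: MoeglinWaldspurger1995, I.2.10] -/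
theorem exists_nhds_finitePart_bound_of_packages (Wloc : L → HeightOneSpectrum (𝓞 K) → ℂ → ℂ) (S : L → Finset (HeightOneSpectrum (𝓞 K)))
    {e : HeightOneSpectrum (𝓞 L) → ℤ} (he : ∀ᶠ w in cofinite, e w = 0) (n : L → HeightOneSpectrum (𝓞 L) → ℕ)
    (S₀ : Finset (HeightOneSpectrum (𝓞 K))) (S₀' : Finset (HeightOneSpectrum (𝓞 L)))
    (hhol : ∀ ξ : L, ∀ v ∈ S ξ, DifferentiableOn ℂ (Wloc ξ v) {z : ℂ | 1 < z.re})
    (hbd : ∀ σ₁ : ℝ, 1 < σ₁ → ∃ (B : ℝ) (k : ℕ), 1 ≤ B ∧ ∀ ξ : L, ξ ≠ 0 →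
      (∀ w : HeightOneSpectrum (𝓞 L), (ξ : w.adicCompletion L) ∈ primePowBall (w.adicCompletion L) (e w)) →
      ∀ v ∈ S ξ, ∀ z : ℂ, σ₁ ≤ z.re →
        ‖Wloc ξ v z‖ ≤ (if v ∈ S₀ then B else 1) *
          (letI := Extension.fintype (𝓞 K) K L (𝓞 L) v; ∏ w : v.Extension (𝓞 L), (if w.1 ∈ S₀' ∨ 1 ≤ n ξ w.1 then 2 * ((n ξ w.1 : ℝ) + 1) else 1)) ^ k)
    (hn : ∀ ξ : L, ξ ≠ 0 → (∀ w : HeightOneSpectrum (𝓞 L), (ξ : w.adicCompletion L) ∈ primePowBall (w.adicCompletion L) (e w)) →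
      ∀ v ∈ S ξ, ∀ w : v.Extension (𝓞 L), (w.1 ∈ S₀' ∨ 1 ≤ n ξ w.1) →
        (ξ : w.1.adicCompletion L) ∈ primePowBall (w.1.adicCompletion L) (e w.1 + n ξ w.1) ∧
          (ξ : w.1.adicCompletion L) ∉ primePowBall (w.1.adicCompletion L) (e w.1 + n ξ w.1 + 1))
    (hvan : ∀ ξ : L, ξ ≠ 0 → ∀ w : HeightOneSpectrum (𝓞 L), (ξ : w.adicCompletion L) ∉ primePowBall (w.adicCompletion L) (e w) →
      w.under (𝓞 K) ∈ S ξ ∧ Wloc ξ (w.under (𝓞 K)) = 0)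
    (z₀ : ℂ) (hz₀ : 1 < z₀.re) :
    ∃ V ∈ nhds z₀, ∃ (C : ℝ) (a : ℕ), 0 ≤ C ∧ ∀ z ∈ V, ∀ ξ : L, ξ ≠ 0 →
      (∀ w : HeightOneSpectrum (𝓞 L), (ξ : w.adicCompletion L) ∈ primePowBall (w.adicCompletion L) (e w)) →
      ‖∏ v ∈ S ξ, Wloc ξ v z‖ ≤ C * (1 + ‖mixedEmbedding L ξ‖) ^ a := by
  obtain ⟨-, hbd2, -⟩ := exists_finitePart_bounds_of_packages Wloc S he n S₀ S₀' hhol hbd hn hvan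
  obtain ⟨C, a, hC, h⟩ := hbd2 ((1 + z₀.re) / 2) (by linarith)
  refine ⟨{z : ℂ | (1 + z₀.re) / 2 < z.re}, (isOpen_lt continuous_const Complex.continuous_re).mem_nhds (by simp only [Set.mem_setOf_eq]; linarith),
    C, a, hC, fun z hz ξ hξ hbox => h ξ hξ hbox z (le_of_lt hz)⟩

/-! ## §3  The CM reading `K = L⁺` -/

section CM

variable {L' : Type} [Field L'] [NumberField L']

/-- **THE CM FRAME** (`K := L⁺ = maximalRealSubfield L'`): the same three conclusions for the finite part of the Whittaker coefficient of the spherical Eisenstein series on `U(2,1)_{L'∕L'⁺}`,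
from the per-place packages at the finite places of `L'⁺` (the binder specialisation C3₃ consumes; no new content). [cite: Garrett2018, §2.8] [cite: Bump1997, §3.7] -/
theorem exists_finitePart_bounds_of_packages_cm (Wloc : L' → HeightOneSpectrum (𝓞 ↥(maximalRealSubfield L')) → ℂ → ℂ)
    (S : L' → Finset (HeightOneSpectrum (𝓞 ↥(maximalRealSubfield L'))))
    {e : HeightOneSpectrum (𝓞 L') → ℤ} (he : ∀ᶠ w in cofinite, e w = 0) (n : L' → HeightOneSpectrum (𝓞 L') → ℕ)
    (S₀ : Finset (HeightOneSpectrum (𝓞 ↥(maximalRealSubfield L')))) (S₀' : Finset (HeightOneSpectrum (𝓞 L')))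
    (hhol : ∀ ξ : L', ∀ v ∈ S ξ, DifferentiableOn ℂ (Wloc ξ v) {z : ℂ | 1 < z.re})
    (hbd : ∀ σ₁ : ℝ, 1 < σ₁ → ∃ (B : ℝ) (k : ℕ), 1 ≤ B ∧ ∀ ξ : L', ξ ≠ 0 →
      (∀ w : HeightOneSpectrum (𝓞 L'), (ξ : w.adicCompletion L') ∈ primePowBall (w.adicCompletion L') (e w)) →
      ∀ v ∈ S ξ, ∀ z : ℂ, σ₁ ≤ z.re →
        ‖Wloc ξ v z‖ ≤ (if v ∈ S₀ then B else 1) *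
          (letI := Extension.fintype (𝓞 ↥(maximalRealSubfield L')) (↥(maximalRealSubfield L')) L' (𝓞 L') v;
            ∏ w : v.Extension (𝓞 L'), (if w.1 ∈ S₀' ∨ 1 ≤ n ξ w.1 then 2 * ((n ξ w.1 : ℝ) + 1) else 1)) ^ k)
    (hn : ∀ ξ : L', ξ ≠ 0 → (∀ w : HeightOneSpectrum (𝓞 L'), (ξ : w.adicCompletion L') ∈ primePowBall (w.adicCompletion L') (e w)) →
      ∀ v ∈ S ξ, ∀ w : v.Extension (𝓞 L'), (w.1 ∈ S₀' ∨ 1 ≤ n ξ w.1) →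
        (ξ : w.1.adicCompletion L') ∈ primePowBall (w.1.adicCompletion L') (e w.1 + n ξ w.1) ∧
          (ξ : w.1.adicCompletion L') ∉ primePowBall (w.1.adicCompletion L') (e w.1 + n ξ w.1 + 1))
    (hvan : ∀ ξ : L', ξ ≠ 0 → ∀ w : HeightOneSpectrum (𝓞 L'), (ξ : w.adicCompletion L') ∉ primePowBall (w.adicCompletion L') (e w) →
      w.under (𝓞 ↥(maximalRealSubfield L')) ∈ S ξ ∧ Wloc ξ (w.under (𝓞 ↥(maximalRealSubfield L'))) = 0) :
    (∀ ξ : L', DifferentiableOn ℂ (fun z => ∏ v ∈ S ξ, Wloc ξ v z) {z : ℂ | 1 < z.re}) ∧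
    (∀ σ₁ : ℝ, 1 < σ₁ → ∃ (C : ℝ) (a : ℕ), 0 ≤ C ∧ ∀ ξ : L', ξ ≠ 0 →
      (∀ w : HeightOneSpectrum (𝓞 L'), (ξ : w.adicCompletion L') ∈ primePowBall (w.adicCompletion L') (e w)) →
      ∀ z : ℂ, σ₁ ≤ z.re → ‖∏ v ∈ S ξ, Wloc ξ v z‖ ≤ C * (1 + ‖mixedEmbedding L' ξ‖) ^ a) ∧
    (∀ ξ : L', ξ ≠ 0 → (∃ w : HeightOneSpectrum (𝓞 L'), (ξ : w.adicCompletion L') ∉ primePowBall (w.adicCompletion L') (e w)) →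
      ∀ z : ℂ, ∏ v ∈ S ξ, Wloc ξ v z = 0) :=
  exists_finitePart_bounds_of_packages Wloc S he n S₀ S₀' hhol hbd hn hvan

end CM

end Summit.HodgeConjecture.HodgeConjecture.Cruxes.H413.K2E1WhittakerFinitePartU3

end
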